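import Literature.Geometry.Symplectic.SteinDomain
import Literature.Topology.FourManifolds.ClosedBallTangent
import Literature.Topology.FourManifolds.ClosedBallHandles
import Literature.Topology.FourManifolds.KnotFraming
import HarnessLib

/-!
# The standard Stein structure on the 4-ball `B⁴ ⊂ ℂ²`

Topic `Literature/Geometry/Symplectic`; a **model** for the Stein layer of the tree
(`SteinDomain.lean`: `SteinStructure`, `IsSteinDomain`; `SteinBoundaryContact.lean`,
`LegendrianRealisation.lean`, `SteinHandlebodies.lean`, `AkbulutMatveyev.lean`), which so far had
no formally exhibited inhabitant (review of p15350, item 3).  Everything here is **proved**: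

* `steinStructureClosedBall : SteinStructure B⁴` and `isSteinDomain_closedBall : IsSteinDomain B⁴`
  for the closed unit ball `B⁴ = 𝔻⁴ ⊆ ℝ⁴ = ℂ²` with the manifold-with-boundary structure of
  `ClosedBall.lean` — *"the standard PC structure on `B⁴`"* of Akbulut–Matveyev (1998), Thm. 2
  (1) (*"The standard PC structure on `B⁴` can be extended over 1-handles …"*), i.e. the base
  case of Eliashberg's theorem (Gompf 1998, Thm. 1.3); Cieliebak–Eliashberg (2012), Ch. 2:
  `φ = |z|²` is an exhausting `J`-convex function on `ℂⁿ`, so its sublevel sets are Stein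
  domains.

The structure: `J` is the complex structure `J₀ (x₀, x₁, x₂, x₃) = (-x₁, x₀, -x₃, x₂)` of
`ℂ² = ℝ⁴` (`z₁ = x₀ + i x₁`, `z₂ = x₂ + i x₃`), transported to the tangent spaces of the
manifold `B⁴` — which Mathlib reads in the preferred chart at each point — by the differential
`Dι_x = closedBallCoeDeriv x` of the inclusion `ι : B⁴ ↪ ℝ⁴` (`ClosedBallTangent.lean`):
`J_x = Dι_x⁻¹ ∘ J₀ ∘ Dι_x` (`ballJ`); `φ = ‖x‖²` (`ballHeight 3` of `ClosedBallHandles.lean`).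
The fields of `SteinStructure`:

* `J² = -1` (`ballJ_sq`);
* `J` maps smooth vector fields to smooth vector fields (`isSmoothVectorField_ballJ`): by the
  dictionary `contMDiff_tangentSection_iff_closedBall` a vector field on `B⁴` is smooth iff its
  ambient representative `Dι (X)` is, and that of `J X` is `J₀ ∘ Dι (X)`;
* integrability (`nijenhuis_ballJ_eq_zero`): every smooth vector field of `B⁴` is the pull-back
  (`VectorField.mpullback`) along `ι` of its ambient representative `X̃` (`ambRep`, `C^∞` within
  the closed ball, `contDiffWithinAt_ambRep`), so by the naturality of the Lie bracket
  (Mathlib's `VectorField.mpullback_mlieBracketWithin`) the four brackets of the Nijenhuis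
  tensor are pull-backs of Lie brackets *within the closed ball* of `X̃`, `Ỹ`, `J₀X̃`, `J₀Ỹ`
  (`mlieBracket_eq_ambRep`), and the flat Nijenhuis expression of the *constant* `J₀` vanishes
  identically (`ambient_nijenhuis_eq_zero`: expand `D(J₀V) = J₀ DV` and `J₀² = -1`);
* `φ` is `C^∞` (`contMDiff_ballHeight`);
* strict `J`-convexity (`ballPhi_convex`): `d^ℂφ = dφ ∘ J` is the pull-back along `ι` of the
  ambient 1-form `α₀(w) = 2⟪w, J₀ ·⟫` (`dComplex_ballJ_ballPhi_eq`); its chart representative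
  at `x` is the pull-back of `α₀` along the inverse ambient chart
  (`inChart_dComplex_ballJ_ballPhi`), so by naturality of `d` within the half-space
  (Mathlib's `extDerivWithin_pullback`) the tree's manifold exterior derivative is
  `dd^ℂφ_x = dα₀ ∘ (Dι_x × Dι_x)` (`mextDeriv_dComplex_ballJ_ballPhi`), and
  `dα₀(a, b) = 4⟪a, J₀ b⟫` in Mathlib's normalisation (`extDeriv_ambAlpha_apply`), whence
  `-dd^ℂφ_x(v, J_x v) = 4 ‖Dι_x v‖² > 0` for `v ≠ 0` (`neg_mextDeriv_dComplex_ballJ_ballPhi`);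
* `∂B⁴ = {‖x‖ = 1} = {φ = sup φ = 1}` (`isBoundaryPoint_iff_ballPhi_eq`, from
  `boundary_closedBall`) and `dφ ≠ 0` on `∂B⁴` (`mfderiv_ballPhi_ne_zero`, from
  `not_isMCriticalPt_ballHeight_of_norm_eq_one`).

Also: `isSteinDomain_and_isHandlebody_closedBall` — `B⁴` is a compact orientable Stein
`0`-handlebody, the `k = 0` instance of the conclusion of `Gompf1998_thm13_noTwoHandles`.

## References

* S. Akbulut, R. Matveyev, *A convex decomposition theorem for 4-manifolds*, IMRN 1998, no. 7,
  371–381 (arXiv:math/0010166), Thm. 2 (1). [AkbulutMatveyev1998]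
* R. E. Gompf, *Handlebody construction of Stein surfaces*, Ann. of Math. 148 (1998), 619–693,
  Thm. 1.3 and §1. [Gompf1998]
* K. Cieliebak, Ya. Eliashberg, *From Stein to Weinstein and back*, AMS Colloquium Publ. 59
  (2012), Ch. 2 (`J`-convex functions; `|z|²` on `ℂⁿ`). [CieliebakEliashberg2012]
-/

noncomputable section

open scoped Manifold ContDiff Topology RealInnerProductSpace
open Set Function Metric VectorField

namespace Literature.Geometry.Symplectic

open Literature.Topology.FourManifolds

/-- The model vector space `ℝ⁴` of the tangent spaces. [folklore] -/
local notation "E4" => EuclideanSpace ℝ (Fin 4)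

/-- Local notation: the closed unit 4-ball. -/
local notation "𝔻⁴" => (Metric.closedBall (0 : EuclideanSpace ℝ (Fin 4)) 1)

/-! ### The standard complex structure of `ℂ² = ℝ⁴` -/

/-- The standard complex structure `J₀` of `ℝ⁴ = ℂ²` (multiplication by `i` in the coordinates
`z₁ = x₀ + i x₁`, `z₂ = x₂ + i x₃`): `(x₀, x₁, x₂, x₃) ↦ (-x₁, x₀, -x₃, x₂)`, as a linear map.
[folklore] -/
def stdComplexStructureLin : E4 →ₗ[ℝ] E4 where
  toFun v := WithLp.toLp 2 ![-v 1, v 0, -v 3, v 2]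
  map_add' v w := by
    ext i; fin_cases i <;> simp <;> ring
  map_smul' c v := by
    ext i; fin_cases i <;> simp

/-- The standard complex structure `J₀` of `ℝ⁴ = ℂ²` as a continuous linear map. [folklore] -/
def stdComplexStructure : E4 →L[ℝ] E4 :=
  LinearMap.toContinuousLinearMap stdComplexStructureLin

/-- Coordinate `0` of `J₀ v` is `-v₁`. [folklore] -/
@[simp] theorem stdComplexStructure_apply_zero (v : E4) : stdComplexStructure v 0 = -v 1 := rfl

/-- Coordinate `1` of `J₀ v` is `v₀`. [folklore] -/
@[simp] theorem stdComplexStructure_apply_one (v : E4) : stdComplexStructure v 1 = v 0 := rfl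

/-- Coordinate `2` of `J₀ v` is `-v₃`. [folklore] -/
@[simp] theorem stdComplexStructure_apply_two (v : E4) : stdComplexStructure v 2 = -v 3 := rfl

/-- Coordinate `3` of `J₀ v` is `v₂`. [folklore] -/
@[simp] theorem stdComplexStructure_apply_three (v : E4) : stdComplexStructure v 3 = v 2 := rfl

/-- `J₀² = -1`. [folklore] -/
theorem stdComplexStructure_sq (v : E4) : stdComplexStructure (stdComplexStructure v) = -v := by
  ext i; fin_cases i <;> simp

/-- `J₀` is skew: `⟪v, J₀ v⟫ = 0`. [folklore] -/
theorem inner_stdComplexStructure_self (v : E4) : ⟪v, stdComplexStructure v⟫ = 0 := by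
  rw [inner_fin_four]; simp; ring

/-- `J₀` is an isometry: `⟪J₀ v, J₀ w⟫ = ⟪v, w⟫`. [folklore] -/
theorem inner_stdComplexStructure_stdComplexStructure (v w : E4) :
    ⟪stdComplexStructure v, stdComplexStructure w⟫ = ⟪v, w⟫ := by
  rw [inner_fin_four, inner_fin_four]; simp; ring

/-- `J₀` is skew-adjoint: `⟪v, J₀ w⟫ = -⟪J₀ v, w⟫`. [folklore] -/
theorem inner_stdComplexStructure_right (v w : E4) :
    ⟪v, stdComplexStructure w⟫ = -⟪stdComplexStructure v, w⟫ := by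
  rw [inner_fin_four, inner_fin_four]; simp; ring

/-! ### The almost complex structure of the 4-ball, read in the charts -/

/-- **The complex structure of `B⁴ ⊂ ℂ²` on the tangent space at `x`, read in the preferred
chart at `x`**: `J_x = (Dι_x)⁻¹ ∘ J₀ ∘ Dι_x`, where `Dι_x = closedBallCoeDeriv x` is the
differential of the inclusion `B⁴ ↪ ℝ⁴` (`ClosedBallTangent.lean`). [folklore] -/
def ballJ (x : 𝔻⁴) : E4 →L[ℝ] E4 :=
  ((closedBallCoeDeriv x).symm : E4 →L[ℝ] E4).comp
    (stdComplexStructure.comp (closedBallCoeDeriv x : E4 →L[ℝ] E4))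

/-- Unfolding `ballJ`. [folklore] -/
theorem ballJ_apply (x : 𝔻⁴) (v : E4) :
    ballJ x v = (closedBallCoeDeriv x).symm (stdComplexStructure (closedBallCoeDeriv x v)) :=
  rfl

/-- Read ambiently, `J_x` is `J₀`: `Dι_x (J_x v) = J₀ (Dι_x v)`. [folklore] -/
@[simp] theorem closedBallCoeDeriv_ballJ (x : 𝔻⁴) (v : E4) :
    closedBallCoeDeriv x (ballJ x v) = stdComplexStructure (closedBallCoeDeriv x v) := by
  rw [ballJ_apply, ContinuousLinearEquiv.apply_symm_apply]

/-- `J_x² = -1`. [folklore] -/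
theorem ballJ_sq (x : 𝔻⁴) (v : E4) : ballJ x (ballJ x v) = -v := by
  apply (closedBallCoeDeriv x).injective
  rw [closedBallCoeDeriv_ballJ, closedBallCoeDeriv_ballJ, stdComplexStructure_sq, map_neg]

/-- `J_x` applied to a pulled-back vector: `J_x ((Dι_x)⁻¹ u) = (Dι_x)⁻¹ (J₀ u)`. [folklore] -/
theorem ballJ_symm_apply (x : 𝔻⁴) (u : E4) :
    ballJ x ((closedBallCoeDeriv x).symm u) = (closedBallCoeDeriv x).symm (stdComplexStructure u) := by
  rw [ballJ_apply, ContinuousLinearEquiv.apply_symm_apply]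

/-- **`J` is smooth**: it maps smooth vector fields of `B⁴` to smooth vector fields (the ambient
representative of `J X` is `J₀` applied to that of `X`; `contMDiff_tangentSection_iff_closedBall`).
[folklore] -/
theorem isSmoothVectorField_ballJ (X : (x : 𝔻⁴) → TangentSpace (𝓡∂ 4) x)
    (hX : IsSmoothVectorField (𝔻⁴) X) : IsSmoothVectorField (𝔻⁴) fun x => ballJ x (X x) := by
  unfold IsSmoothVectorField at hX ⊢
  rw [contMDiff_tangentSection_iff_closedBall] at hX ⊢
  have h : ContMDiff (𝓡∂ 4) 𝓘(ℝ, E4) ∞ fun x : 𝔻⁴ => stdComplexStructure (closedBallCoeDeriv x (X x)) :=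
    stdComplexStructure.contDiff.comp_contMDiff hX
  refine h.congr fun x => ?_
  exact closedBallCoeDeriv_ballJ x (X x)

/-! ### The `J`-convex function `φ = ‖x‖²` -/

/-- The defining function `φ = ‖x‖²` of the ball (`ballHeight 3` of `ClosedBallHandles.lean`).
[folklore] -/
abbrev ballPhi : 𝔻⁴ → ℝ := ballHeight 3

/-- `φ = ‖x‖²`. [folklore] -/
theorem ballPhi_apply (x : 𝔻⁴) : ballPhi x = ‖(x : E4)‖ ^ 2 := rfl

/-- `sup φ = 1` on the closed unit ball (attained on the unit sphere). [folklore] -/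
theorem sSup_range_ballPhi : sSup (range ballPhi) = 1 := by
  have h1 : IsGreatest (range ballPhi) 1 := by
    refine ⟨⟨⟨EuclideanSpace.single 0 1, by simp⟩, by simp [ballPhi_apply]⟩, ?_⟩
    rintro _ ⟨x, rfl⟩
    rw [ballPhi_apply, sq_le_one_iff₀ (norm_nonneg _)]
    exact mem_closedBall_zero_iff.1 x.2
  exact h1.csSup_eq

/-- A point of `B⁴` is a boundary point iff `‖x‖ = 1` (`boundary_closedBall`). [folklore] -/
theorem isBoundaryPoint_iff_norm_eq_one (x : 𝔻⁴) :
    (𝓡∂ 4).IsBoundaryPoint x ↔ ‖(x : E4)‖ = 1 := by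
  have h := Set.ext_iff.1 (boundary_closedBall (n := 3)) x
  exact h

/-- **The boundary of `B⁴` is the maximum level set of `φ`.** [folklore] -/
theorem isBoundaryPoint_iff_ballPhi_eq (x : 𝔻⁴) :
    (𝓡∂ 4).IsBoundaryPoint x ↔ ballPhi x = sSup (range ballPhi) := by
  rw [sSup_range_ballPhi, isBoundaryPoint_iff_norm_eq_one, ballPhi_apply,
    pow_eq_one_iff_of_nonneg (norm_nonneg _) two_ne_zero]

/-- **`φ` is regular on the boundary** (`not_isMCriticalPt_ballHeight_of_norm_eq_one`). [folklore] -/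
theorem mfderiv_ballPhi_ne_zero {x : 𝔻⁴} (hx : (𝓡∂ 4).IsBoundaryPoint x) :
    mfderiv (𝓡∂ 4) 𝓘(ℝ, ℝ) ballPhi x ≠ 0 :=
  not_isMCriticalPt_ballHeight_of_norm_eq_one ((isBoundaryPoint_iff_norm_eq_one x).1 hx)

/-- The ambient derivative of `‖·‖²` at `w` is `2⟪w, ·⟫`. [folklore] -/
theorem hasFDerivAt_norm_sq_four (w : E4) :
    HasFDerivAt (fun y : E4 => ‖y‖ ^ 2) (2 • innerSL ℝ w) w := by
  have h := (hasFDerivAt_id w).norm_sq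
  simpa using h

/-- `(2 • ⟪w, ·⟫) u = 2 ⟪w, u⟫`. [folklore] -/
theorem two_smul_innerSL_apply (w u : E4) : (2 • innerSL ℝ w) u = 2 * ⟪w, u⟫ := by
  rw [two_smul, add_apply, innerSL_apply_apply, two_mul]

/-- **The differential of `φ`**: `dφ_x v = 2⟪x, Dι_x v⟫`. [folklore] -/
theorem mfderiv_ballPhi_apply (x : 𝔻⁴) (v : E4) :
    mfderiv (𝓡∂ 4) 𝓘(ℝ, ℝ) ballPhi x v = 2 * ⟪(x : E4), closedBallCoeDeriv x v⟫ := by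
  have h := mfderiv_comp_coe_closedBall (g := fun y : E4 => ‖y‖ ^ 2) x
    (hasFDerivAt_norm_sq_four (x : E4)).differentiableAt
  rw [(hasFDerivAt_norm_sq_four (x : E4)).fderiv] at h
  change mfderiv (𝓡∂ 4) 𝓘(ℝ, ℝ) (fun y : 𝔻⁴ => ‖(y : E4)‖ ^ 2) x v = _
  rw [h]
  exact two_smul_innerSL_apply _ _

/-! ### The ambient 1-form `d^ℂφ₀ = 2⟪w, J₀ ·⟫` and its exterior derivative -/

/-- The ambient 1-form `α₀ = dφ₀ ∘ J₀`, `α₀(w)(v) = 2⟪w, J₀ v⟫`, as a continuous linear map of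
the base point `w` (it is linear in `w`). [folklore] -/
def ambAlphaCLM : E4 →L[ℝ] (E4 [⋀^Fin 1]→L[ℝ] ℝ) :=
  ((ContinuousAlternatingMap.ofSubsingletonLIE (𝕜 := ℝ) (E := E4) (F := ℝ) (0 : Fin 1)).toContinuousLinearEquiv :
      (E4 →L[ℝ] ℝ) →L[ℝ] (E4 [⋀^Fin 1]→L[ℝ] ℝ)).comp
    (((ContinuousLinearMap.compL ℝ E4 E4 ℝ).flip ((2 : ℝ) • stdComplexStructure)).comp
      (innerSL ℝ : E4 →L[ℝ] E4 →L[ℝ] ℝ))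

/-- The ambient 1-form `α₀ = dφ₀ ∘ J₀` as a differential form on `ℝ⁴`. [folklore] -/
def ambAlpha (w : E4) : E4 [⋀^Fin 1]→L[ℝ] ℝ := ambAlphaCLM w

/-- `α₀(w)(v) = 2⟪w, J₀ v₀⟫`. [folklore] -/
@[simp] theorem ambAlpha_apply (w : E4) (v : Fin 1 → E4) :
    ambAlpha w v = 2 * ⟪w, stdComplexStructure (v 0)⟫ := by
  simp [ambAlpha, ambAlphaCLM]

/-- `α₀` is linear in the base point, hence its own derivative. [folklore] -/
theorem hasFDerivAt_ambAlpha (w : E4) : HasFDerivAt ambAlpha ambAlphaCLM w :=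
  ambAlphaCLM.hasFDerivAt

/-- `α₀` is smooth. [folklore] -/
theorem contDiff_ambAlpha : ContDiff ℝ ∞ ambAlpha := ambAlphaCLM.contDiff

/-- `α₀` is differentiable. [folklore] -/
theorem differentiable_ambAlpha : Differentiable ℝ ambAlpha := ambAlphaCLM.differentiable

/-- `w ↦ ⟪w, c⟫` has derivative `⟪c, ·⟫ = ⟪·, c⟫`. [folklore] -/
theorem hasFDerivAt_inner_const (c w : E4) :
    HasFDerivAt (fun w' : E4 => ⟪w', c⟫) (innerSL ℝ c) w := by
  have : (fun w' : E4 => ⟪w', c⟫) = fun w' => innerSL ℝ c w' := by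
    funext w'
    rw [innerSL_apply_apply, real_inner_comm]
  rw [this]
  exact (innerSL ℝ c).hasFDerivAt

/-- The derivative of `w ↦ 2⟪w, c⟫` in the direction `a` is `2⟪a, c⟫`. [folklore] -/
theorem fderiv_two_mul_inner_const (c w a : E4) :
    fderiv ℝ (fun w' : E4 => 2 * ⟪w', c⟫) w a = 2 * ⟪a, c⟫ := by
  rw [((hasFDerivAt_inner_const c w).const_mul 2).fderiv]
  simp [real_inner_comm]

/-- **`dα₀(a, b) = 4⟪a, J₀ b⟫`** (Mathlib's normalisation `dα(v₀, v₁) = Dα(v₀)·v₁ - Dα(v₁)·v₀`;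
`J₀` is skew-adjoint). [folklore] -/
theorem extDeriv_ambAlpha_apply (w a b : E4) :
    extDeriv ambAlpha w ![a, b] = 4 * ⟪a, stdComplexStructure b⟫ := by
  rw [extDeriv_apply (differentiable_ambAlpha w)]
  simp [Fin.sum_univ_succ, Fin.removeNth, fderiv_two_mul_inner_const]
  rw [inner_stdComplexStructure_right b a, real_inner_comm (stdComplexStructure b) a]
  ring

/-- **The Levi form of `φ₀ = ‖·‖²` is positive**: `-dα₀(u, J₀ u) = 4‖u‖²`. [folklore] -/
theorem neg_extDeriv_ambAlpha_self (w u : E4) :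
    -(extDeriv ambAlpha w ![u, stdComplexStructure u]) = 4 * ‖u‖ ^ 2 := by
  rw [extDeriv_ambAlpha_apply, stdComplexStructure_sq, inner_neg_right, real_inner_self_eq_norm_sq]
  ring

/-! ### `d^ℂφ` on the ball is the pull-back of `α₀`, and `-dd^ℂφ(v, Jv) > 0` -/

/-- **`d^ℂφ = dφ ∘ J` on `B⁴` is the pull-back of the ambient 1-form `α₀` along the inclusion**:
`(dφ_z ∘ J_z)(v) = 2⟪z, J₀ (Dι_z v)⟫ = α₀(z)(Dι_z v)`. [folklore] -/
theorem dComplex_ballJ_ballPhi_apply (z : 𝔻⁴) (v : Fin 1 → E4) :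
    dComplex ballJ ballPhi z v = ambAlpha (z : E4) (fun i => closedBallCoeDeriv z (v i)) := by
  rw [dComplex_apply, mfderiv_ballPhi_apply, closedBallCoeDeriv_ballJ, ambAlpha_apply]
  rfl

/-- The same, as an identity of forms: `d^ℂφ (z) = α₀(z) ∘ Dι_z`. [folklore] -/
theorem dComplex_ballJ_ballPhi_eq (z : 𝔻⁴) :
    dComplex ballJ ballPhi z =
      (ambAlpha (z : E4)).compContinuousLinearMap (closedBallCoeDeriv z : E4 →L[ℝ] E4) := by
  ext v
  exact dComplex_ballJ_ballPhi_apply z v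

/-- **The chart representative of `d^ℂφ` at `x` is the pull-back of `α₀` along the inverse
ambient chart** (on the chart target): `(d^ℂφ).inChart x (e) = α₀((ambChart x)⁻¹ e) ∘ D(ambChart x)⁻¹(e)`.
[folklore] -/
theorem inChart_dComplex_ballJ_ballPhi (x : 𝔻⁴) {e : E4}
    (he : e ∈ (extChartAt (𝓡∂ 4) x).target) :
    (dComplex ballJ ballPhi).inChart x e =
      (ambAlpha ((closedBallAmbChart x).symm e)).compContinuousLinearMap
        (fderiv ℝ (closedBallAmbChart x).symm e) := by
  ext v
  rw [Kaehler.MForm.inChart_apply, dComplex_ballJ_ballPhi_apply,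
    ContinuousAlternatingMap.compContinuousLinearMap_apply, coe_extChartAt_closedBall_symm_apply x he]
  congr 1
  funext i
  have h := closedBallCoeDeriv_comp_mfderivWithin_extChartAt_symm x he
  exact (congrArg (fun L : E4 →L[ℝ] E4 => L (v i)) h :)

/-- **The manifold exterior derivative of `d^ℂφ` at `x` is the pull-back of `dα₀`**:
`dd^ℂφ_x = dα₀(x) ∘ (Dι_x × Dι_x)` (naturality of `d`, Mathlib's `extDerivWithin_pullback`, applied
in the chart at `x` within the half-space). [folklore] -/
theorem mextDeriv_dComplex_ballJ_ballPhi (x : 𝔻⁴) :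
    Kaehler.mextDeriv (dComplex ballJ ballPhi) x =
      (extDeriv ambAlpha (x : E4)).compContinuousLinearMap (closedBallCoeDeriv x : E4 →L[ℝ] E4) := by
  set f : E4 → E4 := ⇑(closedBallAmbChart x).symm with hf
  set e₀ : E4 := extChartAt (𝓡∂ 4) x x with he₀
  have he₀t : e₀ ∈ (extChartAt (𝓡∂ 4) x).target := mem_extChartAt_target x
  have he₀r : e₀ ∈ range (𝓡∂ 4) := extChartAt_target_subset_range x he₀t
  have hU : UniqueDiffOn ℝ (range (𝓡∂ 4)) := (𝓡∂ 4).uniqueDiffOn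
  have hfd : ∀ e, DifferentiableAt ℝ f e := fun e =>
    ((contDiff_closedBallAmbChart_symm x).differentiable (by simp)) e
  -- the chart representative agrees near `e₀` (within the half-space) with the pull-back of `α₀`
  -- along `f`, written with `fderivWithin`
  have heq : (dComplex ballJ ballPhi).inChart x =ᶠ[𝓝[range (𝓡∂ 4)] e₀]
      fun e => (ambAlpha (f e)).compContinuousLinearMap (fderivWithin ℝ f (range (𝓡∂ 4)) e) := by
    filter_upwards [extChartAt_target_mem_nhdsWithin x] with e he
    rw [inChart_dComplex_ballJ_ballPhi x he,
      fderivWithin_eq_fderiv (hU e (extChartAt_target_subset_range x he)) (hfd e)]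
  have hpt : (dComplex ballJ ballPhi).inChart x e₀ =
      (ambAlpha (f e₀)).compContinuousLinearMap (fderivWithin ℝ f (range (𝓡∂ 4)) e₀) := by
    rw [inChart_dComplex_ballJ_ballPhi x he₀t, fderivWithin_eq_fderiv (hU e₀ he₀r) (hfd e₀)]
  have hpull := extDerivWithin_pullback (r := ∞)
    (differentiable_ambAlpha (f e₀)).differentiableWithinAt
    ((contDiff_closedBallAmbChart_symm x).contDiffAt.contDiffWithinAt (s := range (𝓡∂ 4)) (x := e₀))
    (by rw [minSmoothness_of_isRCLikeNormedField]; exact ENat.LEInfty.out) hU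
    ((𝓡∂ 4).range_subset_closure_interior he₀r) he₀r (mapsTo_univ f _)
  have hfe₀ : f e₀ = (x : E4) := closedBallAmbChart_symm_extChartAt_self x
  have hDf : fderivWithin ℝ f (range (𝓡∂ 4)) e₀ = (closedBallCoeDeriv x : E4 →L[ℝ] E4) := by
    rw [fderivWithin_eq_fderiv (hU e₀ he₀r) (hfd e₀), coe_closedBallCoeDeriv]
  unfold Kaehler.mextDeriv
  rw [mfderiv_extChartAt_self, Filter.EventuallyEq.extDerivWithin_eq heq hpt, hpull,
    extDerivWithin_univ, hfe₀, hDf]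
  ext v
  rfl

/-- **`φ = ‖x‖²` is strictly `J`-convex on `B⁴`**: `-dd^ℂφ_x(v, J_x v) = 4 ‖Dι_x v‖² > 0` for
`v ≠ 0`. [folklore] -/
theorem neg_mextDeriv_dComplex_ballJ_ballPhi (x : 𝔻⁴) (v : E4) :
    -(Kaehler.mextDeriv (dComplex ballJ ballPhi) x ![v, ballJ x v]) =
      4 * ‖closedBallCoeDeriv x v‖ ^ 2 := by
  rw [mextDeriv_dComplex_ballJ_ballPhi]
  change -(extDeriv ambAlpha (x : E4) ((closedBallCoeDeriv x : E4 →L[ℝ] E4) ∘ ![v, ballJ x v])) = _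
  have h : ((closedBallCoeDeriv x : E4 →L[ℝ] E4) ∘ ![v, ballJ x v]) =
      ![closedBallCoeDeriv x v, stdComplexStructure (closedBallCoeDeriv x v)] := by
    funext i
    fin_cases i
    · rfl
    · simp [closedBallCoeDeriv_ballJ]
  rw [h, neg_extDeriv_ambAlpha_self]

/-- Positivity of the Levi form. [folklore] -/
theorem ballPhi_convex (x : 𝔻⁴) (v : E4) (hv : v ≠ 0) :
    0 < -(Kaehler.mextDeriv (dComplex ballJ ballPhi) x ![v, ballJ x v]) := by
  rw [neg_mextDeriv_dComplex_ballJ_ballPhi]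
  have h : closedBallCoeDeriv x v ≠ 0 := fun h0 => hv ((closedBallCoeDeriv x).map_eq_zero_iff.1 h0)
  positivity

/-! ### Integrability: the Nijenhuis tensor of `J` vanishes -/

section Nijenhuis

variable (X : (x : 𝔻⁴) → TangentSpace (𝓡∂ 4) x)

/-- **The ambient representative of a vector field `X` on `B⁴`**: the vector field of `ℝ⁴`
equal to `Dι (X)` on the closed ball and to `0` outside (only its values on the ball matter).
[folklore] -/
def ambRep (w : E4) : E4 :=
  if h : ‖w‖ ≤ 1 then
    closedBallCoeDeriv ⟨w, mem_closedBall_zero_iff.2 h⟩ (X ⟨w, mem_closedBall_zero_iff.2 h⟩)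
  else 0

variable {X}

/-- On the ball the ambient representative is `Dι_x (X x)`. [folklore] -/
@[simp] theorem ambRep_coe (x : 𝔻⁴) : ambRep X x = closedBallCoeDeriv x (X x) := by
  rw [ambRep, dif_pos (mem_closedBall_zero_iff.1 x.2)]

variable (X) in
/-- The ambient representative of `J X` is `J₀` applied to that of `X`. [folklore] -/
theorem ambRep_ballJ : ambRep (fun y => ballJ y (X y)) = fun w => stdComplexStructure (ambRep X w) := by
  funext w
  by_cases h : ‖w‖ ≤ 1
  · rw [ambRep, dif_pos h, ambRep, dif_pos h, closedBallCoeDeriv_ballJ]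
  · rw [ambRep, dif_neg h, ambRep, dif_neg h, map_zero]

variable (X) in
/-- **`X` is the pull-back of its ambient representative along the inclusion.** [folklore] -/
theorem mpullback_ambRep :
    mpullback (𝓡∂ 4) 𝓘(ℝ, E4) (Subtype.val : 𝔻⁴ → E4) (ambRep X) = X := by
  funext x
  rw [mpullback_coe_closedBall, ambRep_coe, ContinuousLinearEquiv.symm_apply_apply]

variable (X) in
/-- `J X` is the pull-back of `J₀ ∘` (ambient representative of `X`). [folklore] -/
theorem mpullback_stdComplexStructure_ambRep :
    mpullback (𝓡∂ 4) 𝓘(ℝ, E4) (Subtype.val : 𝔻⁴ → E4) (fun w => stdComplexStructure (ambRep X w)) =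
      fun y => ballJ y (X y) := by
  rw [← ambRep_ballJ, mpullback_ambRep]

/-- The image of a neighbourhood of `x` in the ball is a neighbourhood of `x` within the closed
ball set. [folklore] -/
theorem image_coe_mem_nhdsWithin {x : 𝔻⁴} {U : Set (𝔻⁴)} (hU : U ∈ 𝓝 x) :
    Subtype.val '' U ∈ 𝓝[(𝔻⁴ : Set E4)] (x : E4) := by
  rw [← map_nhds_subtype_val]
  exact Filter.image_mem_map hU

/-- **A smooth vector field on `B⁴` has an ambient representative which is `C^∞` within the
closed ball** (as a map `ℝ⁴ → ℝ⁴`). [folklore] -/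
theorem contDiffWithinAt_ambRep (hX : IsSmoothVectorField (𝔻⁴) X) (x : 𝔻⁴) :
    ContDiffWithinAt ℝ ∞ (ambRep X) (𝔻⁴ : Set E4) (x : E4) := by
  -- the ambient map `g = Dι (X)` on the ball is smooth in the manifold sense
  set g : 𝔻⁴ → E4 := fun y => closedBallCoeDeriv y (X y) with hg_def
  have hg : ContMDiffAt (𝓡∂ 4) 𝓘(ℝ, E4) ∞ g x := by
    unfold IsSmoothVectorField at hX
    exact (contMDiff_tangentSection_iff_closedBall.1 hX) x
  rw [contMDiffAt_iff] at hg
  obtain ⟨-, hg⟩ := hg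
  simp only [extChartAt_model_space_eq_id, PartialEquiv.refl_coe, CompTriple.comp_eq] at hg
  rw [extChartAt_closedBall_self] at hg
  -- compose with the ambient chart at `x` on the image `S` of the chart source
  set S : Set E4 := Subtype.val '' (extChartAt (𝓡∂ 4) x).source with hS
  have hA : ContDiffWithinAt ℝ ∞ (closedBallAmbChart x) S (x : E4) :=
    (contDiffAt_closedBallAmbChart x (coe_mem_closedBallAmbChart_source x)).contDiffWithinAt
  have hmaps : MapsTo (closedBallAmbChart x) S (range (𝓡∂ 4)) := by
    rintro _ ⟨y, -, rfl⟩
    rw [← extChartAt_closedBall_apply]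
    exact ⟨chartAt _ x y, rfl⟩
  have hcomp : ContDiffWithinAt ℝ ∞ ((g ∘ (extChartAt (𝓡∂ 4) x).symm) ∘ closedBallAmbChart x) S
      (x : E4) := hg.comp (x : E4) hA hmaps
  have hS𝔻 : S ∈ 𝓝[(𝔻⁴ : Set E4)] (x : E4) :=
    image_coe_mem_nhdsWithin (extChartAt_source_mem_nhds (I := 𝓡∂ 4) x)
  refine (hcomp.congr (fun w hw => ?_) ?_).mono_of_mem_nhdsWithin hS𝔻
  · obtain ⟨y, hy, rfl⟩ := hw
    rw [ambRep_coe, comp_apply, comp_apply, ← extChartAt_closedBall_apply,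
      (extChartAt (𝓡∂ 4) x).left_inv hy]
  · rw [ambRep_coe, comp_apply, comp_apply, ← extChartAt_closedBall_apply,
      (extChartAt (𝓡∂ 4) x).left_inv (mem_extChartAt_source x)]

/-- Hence the ambient representative is differentiable within the closed ball in the manifold
sense required by Mathlib's Lie-bracket naturality. [folklore] -/
theorem mdifferentiableWithinAt_ambRep (hX : IsSmoothVectorField (𝔻⁴) X) (x : 𝔻⁴) :
    MDifferentiableWithinAt 𝓘(ℝ, E4) 𝓘(ℝ, E4).tangent
      (fun w : E4 => (Bundle.TotalSpace.mk' E4 w (ambRep X w) : TangentBundle 𝓘(ℝ, E4) E4))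
      (𝔻⁴ : Set E4) (x : E4) :=
  (contMDiffWithinAt_vectorSpace_iff_contDiffWithinAt.2 (contDiffWithinAt_ambRep hX x)).mdifferentiableWithinAt
    (by simp)

/-- The ambient representative is differentiable within the closed ball (plain calculus).
[folklore] -/
theorem differentiableWithinAt_ambRep (hX : IsSmoothVectorField (𝔻⁴) X) (x : 𝔻⁴) :
    DifferentiableWithinAt ℝ (ambRep X) (𝔻⁴ : Set E4) (x : E4) :=
  (contDiffWithinAt_ambRep hX x).differentiableWithinAt (by simp)

/-- The closed unit ball of `ℝ⁴` is a set of unique differentiability. [folklore] -/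
theorem uniqueDiffOn_closedBall_four : UniqueDiffOn ℝ (𝔻⁴ : Set E4) :=
  uniqueDiffOn_convex (convex_closedBall _ _) (by
    rw [interior_closedBall _ one_ne_zero]
    exact ⟨0, by simp⟩)

/-- **Lie brackets on `B⁴` are ambient Lie brackets**: for smooth vector fields `X`, `Y` on the
ball, `Dι_x [X, Y](x) = [X̃, Ỹ]_{𝔻}(x)`, the Lie bracket of the ambient representatives within
the closed ball (Mathlib's `VectorField.mpullback_mlieBracketWithin` along the inclusion).
[folklore] -/
theorem mlieBracket_eq_ambRep (hX : IsSmoothVectorField (𝔻⁴) X)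
    {Y : (x : 𝔻⁴) → TangentSpace (𝓡∂ 4) x} (hY : IsSmoothVectorField (𝔻⁴) Y) (x : 𝔻⁴) :
    mlieBracket (𝓡∂ 4) X Y x =
      (closedBallCoeDeriv x).symm (lieBracketWithin ℝ (ambRep X) (ambRep Y) (𝔻⁴ : Set E4) x) := by
  haveI : IsManifold (𝓡∂ 4) (minSmoothness ℝ 2) (𝔻⁴) := by
    rw [minSmoothness_of_isRCLikeNormedField]; infer_instance
  haveI : IsManifold 𝓘(ℝ, E4) (minSmoothness ℝ 2) E4 := by
    rw [minSmoothness_of_isRCLikeNormedField]; infer_instance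
  have key := mpullback_mlieBracketWithin (I := 𝓡∂ 4) (I' := 𝓘(ℝ, E4))
    (f := (Subtype.val : 𝔻⁴ → E4)) (V := ambRep X) (W := ambRep Y) (x₀ := x) (s := univ)
    (t := (𝔻⁴ : Set E4)) (n := ∞) (mdifferentiableWithinAt_ambRep hX x)
    (mdifferentiableWithinAt_ambRep hY x) uniqueMDiffOn_univ (contMDiff_coe_closedBall x)
    (mem_univ _) (by rw [minSmoothness_of_isRCLikeNormedField]; exact ENat.LEInfty.out)
    (Filter.univ_mem' fun y => y.2)
  rw [mpullback_ambRep, mpullback_ambRep, mlieBracketWithin_univ] at key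
  rw [← key, mpullback_coe_closedBall, mlieBracketWithin_eq_lieBracketWithin]

/-- The derivative within the ball of `J₀ ∘ X̃` is `J₀ ∘ DX̃`. [folklore] -/
theorem fderivWithin_stdComplexStructure_comp {V : E4 → E4} {w : E4}
    (hV : DifferentiableWithinAt ℝ V (𝔻⁴ : Set E4) w) (hw : w ∈ (𝔻⁴ : Set E4)) :
    fderivWithin ℝ (fun w' => stdComplexStructure (V w')) (𝔻⁴ : Set E4) w =
      stdComplexStructure.comp (fderivWithin ℝ V (𝔻⁴ : Set E4) w) :=
  (stdComplexStructure.hasFDerivAt.comp_hasFDerivWithinAt w hV.hasFDerivWithinAt).fderivWithin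
    (uniqueDiffOn_closedBall_four w hw)

/-- **The Nijenhuis tensor of the constant complex structure `J₀` vanishes** (flat computation
within the closed ball): `[J₀X̃, J₀Ỹ] - J₀[J₀X̃, Ỹ] - J₀[X̃, J₀Ỹ] - [X̃, Ỹ] = 0`. [folklore] -/
theorem ambient_nijenhuis_eq_zero {V W : E4 → E4} {w : E4}
    (hV : DifferentiableWithinAt ℝ V (𝔻⁴ : Set E4) w) (hW : DifferentiableWithinAt ℝ W (𝔻⁴ : Set E4) w)
    (hw : w ∈ (𝔻⁴ : Set E4)) :
    lieBracketWithin ℝ (fun w' => stdComplexStructure (V w')) (fun w' => stdComplexStructure (W w'))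
        (𝔻⁴ : Set E4) w -
      stdComplexStructure (lieBracketWithin ℝ (fun w' => stdComplexStructure (V w')) W (𝔻⁴ : Set E4) w) -
      stdComplexStructure (lieBracketWithin ℝ V (fun w' => stdComplexStructure (W w')) (𝔻⁴ : Set E4) w) -
      lieBracketWithin ℝ V W (𝔻⁴ : Set E4) w = 0 := by
  simp only [lieBracketWithin, fderivWithin_stdComplexStructure_comp hV hw,
    fderivWithin_stdComplexStructure_comp hW hw, ContinuousLinearMap.comp_apply, map_sub,
    stdComplexStructure_sq]
  abel

/-- **`J` is integrable**: the Nijenhuis tensor of `J` vanishes on smooth vector fields of `B⁴`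
(everything is the pull-back of the flat computation for `J₀`). [folklore] -/
theorem nijenhuis_ballJ_eq_zero (hX : IsSmoothVectorField (𝔻⁴) X)
    {Y : (x : 𝔻⁴) → TangentSpace (𝓡∂ 4) x} (hY : IsSmoothVectorField (𝔻⁴) Y) (x : 𝔻⁴) :
    nijenhuis (𝔻⁴) ballJ X Y x = 0 := by
  have hJX := isSmoothVectorField_ballJ X hX
  have hJY := isSmoothVectorField_ballJ Y hY
  simp only [nijenhuis]
  rw [mlieBracket_eq_ambRep hJX hJY, mlieBracket_eq_ambRep hJX hY, mlieBracket_eq_ambRep hX hJY,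
    mlieBracket_eq_ambRep hX hY, ambRep_ballJ, ambRep_ballJ, ballJ_symm_apply, ballJ_symm_apply,
    ← map_sub, ← map_sub, ← map_sub,
    ambient_nijenhuis_eq_zero (differentiableWithinAt_ambRep hX x)
      (differentiableWithinAt_ambRep hY x) x.2, map_zero]
  rfl

end Nijenhuis


/-! ### The Stein structure on `B⁴` -/

/-- **The standard Stein structure on the closed unit 4-ball `B⁴ ⊂ ℂ² = ℝ⁴`**: the complex
structure `J₀` of `ℂ²` (read in the charts of the manifold with boundary `B⁴` through the
differential of the inclusion) and the strictly plurisubharmonic function `φ = ‖z‖²`, whose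
regular maximum level set is `∂B⁴ = S³` — "the standard PC structure on `B⁴`" of
Akbulut–Matveyev (1998), Thm. 2 (1), the base case of Eliashberg's theorem (Gompf 1998,
Thm. 1.3; Cieliebak–Eliashberg 2012, Ex. in §1.1/Ch. 2: `ℂⁿ` with `φ = |z|²` is Stein and every
ball `{φ ≤ c}` is a Stein domain).  All fields are **proved**: `J² = -1`, smoothness of `J`
(ambient smoothness, `ClosedBallTangent.lean`), integrability (the Nijenhuis tensor is the
pull-back of the flat one of the constant `J₀`, which vanishes), smoothness of `φ`, strict
`J`-convexity `-dd^ℂφ(v, Jv) = 4‖Dι v‖² > 0`, `∂B⁴ = {φ = max φ = 1}` and `dφ ≠ 0` there.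
[cite: AkbulutMatveyev1998, Thm. 2 (1)] -/
def steinStructureClosedBall : SteinStructure (𝔻⁴) where
  J := ballJ
  φ := ballPhi
  J_sq := ballJ_sq
  J_smooth := isSmoothVectorField_ballJ
  integrable _ _ hX hY x := nijenhuis_ballJ_eq_zero hX hY x
  φ_smooth := contMDiff_ballHeight 3
  convex := ballPhi_convex
  boundary_eq := isBoundaryPoint_iff_ballPhi_eq
  regular _ hx := mfderiv_ballPhi_ne_zero hx

/-- **The closed unit 4-ball is a Stein domain** (`IsSteinDomain`, `SteinDomain.lean`): the Stein
layer of the tree (`SteinDomain`, `SteinBoundaryContact`, `LegendrianRealisation`,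
`SteinHandlebodies`, `AkbulutMatveyev`) has a model. [cite: Gompf1998, Thm. 1.3] -/
theorem isSteinDomain_closedBall : IsSteinDomain (𝔻⁴) :=
  ⟨steinStructureClosedBall⟩

/-- The `J` of the standard Stein structure is `ballJ` (definitional). [folklore] -/
@[simp] theorem steinStructureClosedBall_J : steinStructureClosedBall.J = ballJ := rfl

/-- The `φ` of the standard Stein structure is `‖·‖²` (definitional). [folklore] -/
@[simp] theorem steinStructureClosedBall_φ : steinStructureClosedBall.φ = ballPhi := rfl

/-- In particular the 4-ball is a compact orientable Stein `0`-handlebody, the `k = 0` instance of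
the conclusion of Eliashberg's theorem `Gompf1998_thm13_noTwoHandles` (`SteinHandlebodies.lean`;
`isHandlebodyOfIndexLE_closedBall`, `isOrientable_closedBall` of `ClosedBallHandles.lean`).
[cite: Gompf1998, Thm. 1.3] -/
theorem isSteinDomain_and_isHandlebody_closedBall :
    IsSteinDomain (𝔻⁴) ∧ IsHandlebodyOfIndexLE 3 0 (𝔻⁴) ∧ IsOrientable (𝓡∂ 4) (𝔻⁴) :=
  ⟨isSteinDomain_closedBall, isHandlebodyOfIndexLE_closedBall 3 0, isOrientable_closedBall 3⟩

end Literature.Geometry.Symplectic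

end
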